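import Literature.NumberTheory.PAdicHodge.TateSenConditionKummerRoute
import HarnessLib

/-!
# Finite extensions of the cyclotomic perfectoid field: Frobenius surjectivity (named fact), and the
# Tate–Sen axiom (TS1) from it BY NAME

Topic `Literature/NumberTheory/PAdicHodge`; sequel to `TateSenConditionKummerRoute`, where the cite-only
Tate–Sen axiom `tate1967_TS1_completedAlgClosure` (Tate 1967 §3.2 Prop. 9 / Berger–Colmez Prop. 4.1.1) is
derived BY NAME (`TateAlmostEtale.tate1967_TS1_of_tame`) from ONE hypothesis (C): the almost-perfectoid package
((Γ): norms are `p`-th powers of norms; (U_s): integers are `p`-th powers modulo `p^s`) of the finite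
extensions `T ⊇ K_∞ = ℚ_p(ζ_{p^∞})` inside `F̄` of degree prime to `p`. The `p`-primary part, the Sylow
reduction, the Galois-closure plumbing and the package of `K_∞` itself (`CyclotomicTowerPthPowers`) are
theorems of the tree. This file names the remaining input as what it is in print — finite extensions of a
perfectoid field are perfectoid — as ONE cite-only fact (closed `def … : Prop`, no `_holds`; size L: almost
purity in characteristic `0` / the different of the cyclotomic tower, not in the tree), derives the package
(C) for ALL finite `T ⊇ K_∞` from it (`TateAlmostEtale.package_of_frobeniusSurjective`, Scholze's Lemma 3.2
argument), and records **`tate1967_TS1_of_scholze2012 : scholze2012_… → tate1967_TS1_completedAlgClosure`**.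

## The printed statements (held: `paper:arxiv-1111.4914`, `paper:arxiv-1301.0792`)

* P. Scholze, *Perfectoid spaces*, Publ. Math. IHÉS 116 (2012). Def. 3.1: "A perfectoid field is a complete
  nonarchimedean field `K` of residue characteristic `p > 0` whose associated rank-1-valuation is nondiscrete,
  such that the Frobenius is surjective on `K°/p`." Lemma 3.2: "… Then `Γ = |K^×|` is `p`-divisible." (proof:
  "for `|p| < |x| ≤ 1` choose `y` such that `|x − y^p| ≤ |p|`. Then `|y|^p = |x|`"). Thm. 3.7 (i): "Let `K` be a
  perfectoid field. Let `L` be a finite extension of `K`. Then `L` (with its natural topology as a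
  finite-dimensional `K`-vector space) is a perfectoid field."
* K. Kedlaya, R. Liu, *Relative p-adic Hodge theory: Foundations*, Astérisque 371 (2015) (arXiv 1301.0792,
  whose numbering we quote): Def. 4.5.1 (perfectoid: characteristic `0`, residue characteristic `p`, not
  discretely valued, `φ̄` surjective on `𝔬_F/(p)`; "any field `F` appearing in Example 4.3.8 is perfectoid"),
  Example 4.3.8 ("… `F` is the completion of `ℚ_p(μ_{p^∞})` for the `p`-adic norm"), Thm. 4.5.6 ("In
  particular, every finite extension of `F` is perfectoid").

## What the fact says (tree vocabulary) and what is a reading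

For a non-archimedean local field `F` of characteristic `0`, residue characteristic `p`
(`hp : valuation F p < 1`), `K₀ = PadicBase F p hp ≅ ℚ_p`, `F̄ = NormedAlgClosure F` with its norm, and
`K_∞ = TateTrace.Kinf hp = ⋃_m K₀(ζ_{p^m}) ⊆ F̄`: for every intermediate field `K_∞ ⊆ T ⊆ F̄` finite over `K_∞`
and every `u ∈ T` with `‖u‖ ≤ 1` there is `w ∈ T` with `‖u − w^p‖ ≤ ‖p‖`. READING (own attribution, ≤ 3 lines):
the closure `T̂` of `T` in `ℂ_F` is `T · K̂_∞`, a finite extension of the completion `K̂_∞` of `ℚ_p(μ_{p^∞})`,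
which is perfectoid (KL Ex. 4.3.8; the tree's `TateAlmostEtale.Kinf_exists_norm_sub_pow_le` is the Frobenius
surjectivity for `K_∞`); so `T̂` is perfectoid (Scholze Thm. 3.7 (i)), i.e. `u = ŵ^p + p·r̂` with `ŵ ∈ T̂°`, and
any `w ∈ T` with `‖w − ŵ‖ ≤ ‖p‖` (density of `T` in `T̂`) has `‖u − w^p‖ ≤ ‖p‖`.
-- TODO(general form): Scholze's Thm. 3.7 for an arbitrary perfectoid base and his tilting equivalence (ii);
-- the tree has no `PerfectoidField` structure, so only this instance (base `ℚ_p(μ_{p^∞})^`) is stated.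

No instance, no notation, no `sorry`; BSD is not proved by any of this.
-/

noncomputable section

open Field ValuativeRel IntermediateField Module
open Literature.NumberTheory.GaloisRepresentations
open Literature.NumberTheory.GaloisRepresentations.IsNonarchimedeanLocalField

namespace Literature.NumberTheory.PAdicHodge

/-- **Finite extensions of the cyclotomic perfectoid field `ℚ_p(μ_{p^∞})^` are perfectoid — Frobenius
surjectivity on `T°/p`** (Scholze 2012, Def. 3.1 with Thm. 3.7 (i): "Let `K` be a perfectoid field. Let `L` be a
finite extension of `K`. Then `L` … is a perfectoid field", perfectoid meaning "the Frobenius is surjective on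
`K°/p`"; the base case `K = ℚ_p(μ_{p^∞})^` is Kedlaya–Liu, Ex. 4.3.8 with Def. 4.5.1, and Thm. 4.5.6 "every
finite extension of `F` is perfectoid"). Tree vocabulary: for `K_∞ = TateTrace.Kinf hp ⊆ F̄` and an intermediate
field `T ⊇ K_∞` of `F̄` finite over `K_∞`, every `u ∈ T` with `‖u‖ ≤ 1` has a `w ∈ T` with `‖u − w^p‖ ≤ ‖p‖`
(read on the dense subfield `T` of the perfectoid field `T̂ = T·K̂_∞`; see the module docstring).
Named fact, no `_holds`. [cite: Scholze2012, Def. 3.1 and Thm. 3.7 (i)]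
[cite: KedlayaLiu2015, arXiv Def. 4.5.1, Ex. 4.3.8, Thm. 4.5.6] -/
def scholze2012_frobeniusSurjective_finite_over_Kinf : Prop :=
  ∀ {F : Type} [Field F] [ValuativeRel F] [TopologicalSpace F] [IsNonarchimedeanLocalField F]
    [CharZero F] {p : ℕ} [Fact p.Prime] (hp : valuation F p < 1)
    (T : IntermediateField (TateTrace.Kinf hp) (NormedAlgClosure F)),
    FiniteDimensional (TateTrace.Kinf hp) T →
    ∀ u ∈ T, ‖u‖ ≤ 1 → ∃ w ∈ T, ‖u - w ^ p‖ ≤ ‖(p : NormedAlgClosure F)‖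

namespace TateAlmostEtale

variable {F : Type} [Field F] [ValuativeRel F] [TopologicalSpace F] [IsNonarchimedeanLocalField F]
  [CharZero F] {p : ℕ} [Fact p.Prime] (hp : valuation F p < 1)

/-- **Scholze's Lemma 3.2 over `K_∞`: Frobenius surjectivity gives the `p`-divisibility of the value group.**
If every integer of `T ⊇ K_∞` is a `p`-th power modulo `p`, then every norm `‖x‖`, `x ∈ T^×`, is `‖c‖^p` for
some `c ∈ T` (rescale `x` by a power of `p` into `‖p‖ < ‖u‖ ≤ 1`, take `‖u − w^p‖ ≤ ‖p‖ < ‖u‖`, and use that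
`‖p‖^{-n}` is a `p`-th power of a norm of `K_∞`, `Kinf_exists_norm_pow_eq`). [cite: Scholze2012, Lemma 3.2] -/
theorem exists_norm_pow_eq_of_frobeniusSurjective
    (T : IntermediateField (TateTrace.Kinf hp) (NormedAlgClosure F))
    (hU : ∀ u ∈ T, ‖u‖ ≤ 1 → ∃ w ∈ T, ‖u - w ^ p‖ ≤ ‖(p : NormedAlgClosure F)‖)
    {x : NormedAlgClosure F} (hx : x ∈ T) (hx0 : x ≠ 0) :
    ∃ c ∈ T, ‖c‖ ^ p = ‖x‖ := by
  have hprime : p.Prime := Fact.out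
  have hp0 : (p : NormedAlgClosure F) ≠ 0 := Nat.cast_ne_zero.mpr hprime.ne_zero
  have hq0 : 0 < ‖(p : NormedAlgClosure F)‖ := norm_pos_iff.mpr hp0
  have hq1 : ‖(p : NormedAlgClosure F)‖ < 1 := by
    rw [PadicBase.norm_natCast_closure hp]; exact PadicBase.norm_p_lt_one hp
  have hxpos : 0 < ‖x‖ := norm_pos_iff.mpr hx0
  -- rescale: `u = x p^{n+1}` with `‖p‖ < ‖u‖ ≤ 1`
  obtain ⟨n, hn1, hn2⟩ := exists_mem_Ioc_zpow hxpos (one_lt_inv₀ hq0 |>.mpr hq1)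
  set u : NormedAlgClosure F := x * (p : NormedAlgClosure F) ^ (n + 1) with hu
  have hpT : (p : NormedAlgClosure F) ∈ T := _root_.natCast_mem T p
  have huT : u ∈ T := mul_mem hx (zpow_mem hpT _)
  have hnu : ‖u‖ = ‖x‖ * ‖(p : NormedAlgClosure F)‖ ^ (n + 1) := by rw [hu, norm_mul, norm_zpow]
  have hu1 : ‖u‖ ≤ 1 := by
    rw [hnu]
    have h := mul_le_mul_of_nonneg_right hn2 (zpow_nonneg hq0.le (n + 1))
    rwa [inv_zpow', zpow_neg, inv_mul_cancel₀ (zpow_ne_zero _ hq0.ne')] at h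
  have hup : ‖(p : NormedAlgClosure F)‖ < ‖u‖ := by
    rw [hnu]
    have h := mul_lt_mul_of_pos_right hn1 (zpow_pos hq0 (n + 1))
    rwa [inv_zpow', zpow_neg, zpow_add_one₀ hq0.ne', ← mul_assoc,
      inv_mul_cancel₀ (zpow_ne_zero _ hq0.ne'), one_mul, ← zpow_add_one₀ hq0.ne'] at h
  -- Frobenius surjectivity: `‖u - w^p‖ ≤ ‖p‖ < ‖u‖`, so `‖w‖^p = ‖u‖`
  obtain ⟨w, hwT, hw⟩ := hU u huT hu1
  have hwp : ‖w‖ ^ p = ‖u‖ := by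
    have hne : ‖u‖ ≠ ‖-(u - w ^ p)‖ := by
      rw [norm_neg]; exact (ne_of_lt (hw.trans_lt hup)).symm
    have h := IsUltrametricDist.norm_add_eq_max_of_norm_ne_norm hne
    rw [norm_neg, max_eq_left (hw.trans hup.le), ← sub_eq_add_neg, sub_sub_cancel] at h
    rw [← norm_pow, h]
  -- `‖p‖^{-(n+1)}` is a `p`-th power of a norm of `K_∞`
  have hpK : (p : NormedAlgClosure F) ^ (-(n + 1)) ∈ TateTrace.Kinf hp :=
    zpow_mem (_root_.natCast_mem _ p) _
  obtain ⟨c₀, hc₀K, hc₀⟩ := Kinf_exists_norm_pow_eq hp hpK (zpow_ne_zero _ hp0)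
  have hc₀T : c₀ ∈ T := T.algebraMap_mem ⟨c₀, hc₀K⟩
  refine ⟨w * c₀, mul_mem hwT hc₀T, ?_⟩
  rw [norm_mul, mul_pow, hwp, hc₀, norm_zpow, hnu, mul_assoc, ← zpow_add₀ hq0.ne',
    add_neg_cancel, zpow_zero, mul_one]

/-- **The almost-perfectoid package of every finite `T ⊇ K_∞` from the named fact** ((Γ) and (U_1)).
[cite: Scholze2012, Lemma 3.2 and Thm. 3.7 (i)] -/
theorem package_of_frobeniusSurjective (h : scholze2012_frobeniusSurjective_finite_over_Kinf)
    (T : IntermediateField (TateTrace.Kinf hp) (NormedAlgClosure F))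
    (hfin : FiniteDimensional (TateTrace.Kinf hp) T) :
    (∀ x ∈ T, x ≠ 0 → ∃ c ∈ T, ‖c‖ ^ p = ‖x‖) ∧
      (∀ u ∈ T, ‖u‖ ≤ 1 → ∃ w ∈ T, ‖u - w ^ p‖ ≤ ‖(p : NormedAlgClosure F)‖ ^ (1 : ℝ)) := by
  refine ⟨fun x hx hx0 => exists_norm_pow_eq_of_frobeniusSurjective hp T (h hp T hfin) hx hx0,
    fun u hu hu1 => ?_⟩
  rw [Real.rpow_one]
  exact h hp T hfin u hu hu1

/-- **The Tate–Sen axiom (TS1) — `tate1967_TS1_completedAlgClosure` — BY NAME from Scholze's theorem**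
(finite extensions of `ℚ_p(μ_{p^∞})^` are perfectoid): the tame hypothesis (C) of
`tate1967_TS1_of_tame` is the special case `p ∤ [T : K_∞]` of `package_of_frobeniusSurjective`. Everything
else (the `p`-primary Kummer route, Sylow reduction, Galois-closure plumbing, the bridge to Berger–Colmez's
(TS1)) is proved in the tree. [cite: Scholze2012, Thm. 3.7 (i)] [cite: Tate1967, §3.2 Prop. 9]
[cite: BergerColmez2008, Prop. 4.1.1] -/
theorem tate1967_TS1_of_scholze2012 (h : scholze2012_frobeniusSurjective_finite_over_Kinf) :
    tate1967_TS1_completedAlgClosure :=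
  tate1967_TS1_of_tame fun hp T hfin _ => ⟨1, one_pos, package_of_frobeniusSurjective hp h T hfin⟩

end TateAlmostEtale

end Literature.NumberTheory.PAdicHodge

end
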